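import Literature.NumberTheory.LFunctions.RayClassLogFreeMiddleRange
import HarnessLib

/-!
# Bombieri's Théorème 14 for the characters of a congruence class group `mod 𝔪`, IV: assembly — the
# log-free zero-density estimate for Hecke `L`-functions, every degree (Weiss 1983, Thm 4.3)

Topic `Literature/NumberTheory/LFunctions`, namespace `Literature.NumberTheory.LFunctions.AbelianDensity`.
Everything here is PROVED (theorems only; no definitions, no named facts).

The ray-class counterpart of the tree's `LogFreeLargeRangeAllDegrees.largeRange_CG_of_le` and
`ClassGroupLogFreeTheorem14AllDegrees.logFreeDensity_classGroup_all` (conductor `1`).  For an abelian Frobenius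
datum `f : 𝔭 ↦ f 𝔭 ∈ G` killing the narrow ray `mod 𝔪 ≠ 0` whose non-trivial characters are non-principal on
the primes `∤ 𝔪` — the characters of a congruence class group `H ⊇ P^𝔪` of `K`, e.g. ALL ray class characters
`mod 𝔪` — and the entire Hecke `L`-functions `L_ψ` (`datumL`) of its non-trivial characters:
* `largeRange_congruence_of_le (n)` — the trivial bound `Σ_{ψ ≠ 0} Σ_{ρ ∈ Z(ψ)} m(ρ) ≤ C P³` for zeros with
  `1/4 ≤ β ≤ 1`, `|γ| ≤ P` (`|d_K|, N𝔪, |G| ≤ P`; Jensen discs about the integer heights);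
* `logFreeDensity_congruence_all (n)` — **the log-free zero-density estimate for the Hecke `L`-functions of a
  congruence class group, every degree**: there are `c_D, C_D > 0` depending only on `n` such that for every
  number field `K` with `n_K ≤ n`, every such datum `mod 𝔪`, every `P ≥ 2` with `|d_K| ≤ P`, `N𝔪 ≤ P`,
  `|G| ≤ P`, `κ_K ≥ 1/P`, all finite sets `Z(ψ)` of zeros of `L_ψ` with `1/4 ≤ β < 1`, `|γ| ≤ P`, and every
  `0 ≤ α ≤ 1`: `Σ_{ψ ≠ 1} Σ_{ρ ∈ Z(ψ), β ≥ α} m(ρ) ≤ C_D P^{c_D(1−α)}`.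
This is the `χ ≠ 1` half of [Weiss1983, Theorem 4.3] / [ThornerZaman2017, Theorem 3.2] (without the
Deuring–Heilbronn factor), uniformly over the number fields of a fixed degree and all moduli; the `χ = 1` half
(`ζ_K` with the Euler factors at `𝔪` removed) is the tree's `logFreeDensity_dedekindZeta₁_all`.  No Landau–Page
theorem is used: for `1 − α < 1/log P` the count at `α' = 1 − 1/log P` already gives `O(1)`.

## References
* [Bombieri1987GrandCrible] E. Bombieri, Astérisque 18 (1987), §6 Théorème 14.
* [ThornerZaman2017] J. Thorner, A. Zaman, Algebra Number Theory 11 (2017), Theorem 3.2, §5–6.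
* [Weiss1983] A. Weiss, J. reine angew. Math. 338 (1983) 56–94, Thm. 4.3.
-/

noncomputable section

open Complex Finset Filter Real MeasureTheory NumberField IsDedekindDomain
open scoped LSeries.notation ArithmeticFunction.vonMangoldt Topology Nat NumberField

namespace Literature.NumberTheory.LFunctions.AbelianDensity

open Literature.NumberTheory.LFunctions.LogFreeLocal Literature.NumberTheory.LFunctions.LogFreeDensity
  Literature.NumberTheory.LFunctions.NumberField Literature.NumberTheory.LFunctions.WeissKernel
open scoped nonZeroDivisors

/-! ### The trivial range: all the zeros with `1/4 ≤ β ≤ 1`, `|γ| ≤ P` -/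

/-- The number of non-trivial characters of `G` is `< |G| ≤ P`. [cite: Bombieri1987GrandCrible, §6 Théorème 14 (proof)] -/
theorem card_filter_ne_zero_le {G : Type*} [CommGroup G] [Finite G] {P : ℝ} (hh : (Nat.card G : ℝ) ≤ P) :
    (((univ : Finset (AddChar (Additive G) ℂ)).filter (fun ψ => ψ ≠ 0)).card : ℝ) ≤ P := by
  classical
  letI : Fintype G := Fintype.ofFinite G
  have h1 : ((univ : Finset (AddChar (Additive G) ℂ)).filter (fun ψ => ψ ≠ 0)).card ≤
      Fintype.card (AddChar (Additive G) ℂ) := (card_le_card (filter_subset _ _)).trans Finset.card_univ.le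
  have h2 : Fintype.card (AddChar (Additive G) ℂ) = Nat.card G := by
    rw [AddChar.card_eq, Nat.card_eq_fintype_card, Fintype.card_congr (Additive.toMul (α := G))]
  calc (((univ : Finset (AddChar (Additive G) ℂ)).filter (fun ψ => ψ ≠ 0)).card : ℝ) ≤ Nat.card G := by
        rw [← h2]; exact_mod_cast h1
    _ ≤ P := hh

open scoped Classical in
/-- **The trivial bound for the characters of a congruence class group, every degree**: for `n_K ≤ n`, `P ≥ 2`
with `|d_K| ≤ P`, `N𝔪 ≤ P` and `|G| ≤ P`, and finite sets `Z(ψ)` of zeros of `L_ψ` (`ψ ≠ 0`) with `1/4 ≤ β ≤ 1`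
and `|γ| ≤ P`: `Σ_{ψ ≠ 0} Σ_{ρ ∈ Z(ψ)} m(ρ) ≤ 1600(n+1) P³` (each zero lies in the Jensen disc `|ρ − (2 + ij)| ≤ 31/16`
about the nearest integer height `j`, whose count is `≤ 32 ℳ_j ≤ 320(n+1) log P`).
[cite: Bombieri1987GrandCrible, §6 Théorème 14 (proof)] -/
theorem largeRange_congruence_of_le (n : ℕ) :
    ∃ C : ℝ, 0 < C ∧
      ∀ (K : Type*) [Field K] [NumberField K], Module.finrank ℚ K ≤ n →
      ∀ (G : Type*) [CommGroup G] [Finite G] (𝔪 : Ideal (𝓞 K)) (f : HeightOneSpectrum (𝓞 K) → G)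
        (h𝔪 : 𝔪 ≠ ⊥) (hray : ArtinKillsRay 𝔪 f)
        (hsep : ∀ χ : AddChar (Additive G) ℂ, χ ≠ 0 →
          ∃ v : HeightOneSpectrum (𝓞 K), ¬ 𝔪 ≤ v.asIdeal ∧ χ (Additive.ofMul (f v)) ≠ 1),
        ∀ P : ℝ, 2 ≤ P → ((NumberField.discr K).natAbs : ℝ) ≤ P → ((Ideal.absNorm 𝔪 : ℕ) : ℝ) ≤ P →
          (Nat.card G : ℝ) ≤ P →
        ∀ Z : AddChar (Additive G) ℂ → Finset ℂ,
          (∀ ψ : AddChar (Additive G) ℂ, ψ ≠ 0 → ∀ ρ ∈ Z ψ,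
              datumL h𝔪 hray hsep ψ ρ = 0 ∧ 1 / 4 ≤ ρ.re ∧ ρ.re ≤ 1 ∧ |ρ.im| ≤ P) →
          ∑ ψ : AddChar (Additive G) ℂ with ψ ≠ 0,
            ∑ ρ ∈ Z ψ, (zeroOrder (datumL h𝔪 hray hsep ψ) ρ : ℝ) ≤ C * P ^ (3 : ℕ) := by
  refine ⟨32 * (10 * ((n : ℝ) + 1)) * 5, by positivity,
    fun K _ _ hnK G _ _ 𝔪 f h𝔪 hray hsep P hP hd hN𝔪 hh Z hZ => ?_⟩
  have hPpos : 0 < P := by linarith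
  set Lp : ℝ := Real.log P with hLp
  have hLp2 : Real.log 2 ≤ Lp := Real.log_le_log (by norm_num) hP
  have hlog2 : (0.69 : ℝ) ≤ Real.log 2 := by have := Real.log_two_gt_d9; linarith
  have hLppos : 0 < Lp := by linarith
  have hLpP : Lp ≤ P := by rw [hLp]; exact (Real.log_le_sub_one_of_pos hPpos).trans (by linarith)
  set M : ℤ := ⌈P⌉ + 1 with hM
  have hMle : (M : ℝ) ≤ P + 2 := by
    rw [hM]; push_cast; linarith [(Int.ceil_lt_add_one P).le]
  set J : Finset ℤ := Finset.Icc (-M) M with hJ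
  have hM0 : 0 ≤ M := by
    rw [hM]; have := Int.ceil_nonneg hPpos.le; omega
  have hcardJ : (J.card : ℝ) ≤ 5 * P := by
    have : (J.card : ℤ) = 2 * M + 1 := by
      rw [hJ, Int.card_Icc]; omega
    have hc : (J.card : ℝ) = 2 * M + 1 := by exact_mod_cast this
    rw [hc]; linarith
  have hdiscj : ∀ j ∈ J, rayDiscBound K 𝔪 j ≤ 10 * ((n : ℝ) + 1) * Lp := by
    intro j hj
    rw [hJ, Finset.mem_Icc] at hj
    have hjabs : |(j : ℝ)| ≤ P + 2 := by
      rw [abs_le]; constructor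
      · have : (-M : ℝ) ≤ j := by exact_mod_cast hj.1
        linarith
      · have : (j : ℝ) ≤ M := by exact_mod_cast hj.2
        linarith
    exact rayDiscBound_le_of_le hnK hP hd hN𝔪 h𝔪 hjabs
  -- per character
  have hper : ∀ ψ : AddChar (Additive G) ℂ, ψ ≠ 0 →
      ∑ ρ ∈ Z ψ, (zeroOrder (datumL h𝔪 hray hsep ψ) ρ : ℝ) ≤ (5 * P) * (32 * (10 * ((n : ℝ) + 1) * Lp)) := by
    intro ψ hψ
    set D := datumData h𝔪 hray hsep ψ hψ with hD
    have hnt := hsep ψ hψ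
    rw [datumL_eq h𝔪 hray hsep hψ]
    set g₀ := D.L with hg₀
    have hdf : Differentiable ℂ g₀ := D.differentiable
    set g : ℂ → ℤ := fun ρ => ⌊ρ.im + 1 / 2⌋ with hg
    have hmaps : ∀ ρ ∈ Z ψ, g ρ ∈ J := by
      intro ρ hρ
      obtain ⟨-, -, -, him⟩ := hZ ψ hψ ρ hρ
      rw [hJ, Finset.mem_Icc, hg]; dsimp only
      have h1 := abs_le.1 him
      have hc1 : (⌈P⌉ : ℝ) ≥ P := Int.le_ceil _
      constructor
      · rw [hM]
        have : (-(⌈P⌉ + 1) : ℤ) ≤ ⌊ρ.im + 1 / 2⌋ := by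
          rw [Int.le_floor]; push_cast; linarith
        linarith
      · rw [hM]
        have : ⌊ρ.im + 1 / 2⌋ ≤ (⌈P⌉ + 1 : ℤ) := by
          have : ⌊ρ.im + 1 / 2⌋ < ⌈P⌉ + 1 + 1 := by
            rw [Int.floor_lt]; push_cast; linarith
          omega
        exact this
    have hfib : ∀ j ∈ J, ∑ ρ ∈ (Z ψ).filter (fun ρ => g ρ = j), (zeroOrder g₀ ρ : ℝ) ≤ 32 * (10 * ((n : ℝ) + 1) * Lp) := by
      intro j hj
      have hfc : g₀ (2 + ((j : ℝ) : ℂ) * I) ≠ 0 := D.L_two_add_ne_zero hnt (j : ℝ)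
      have hsub : (Z ψ).filter (fun ρ => g ρ = j) ⊆ discZeros g₀ (j : ℝ) := by
        intro ρ hρ
        rw [mem_filter] at hρ
        obtain ⟨h0, hβ, hβ1, -⟩ := hZ ψ hψ ρ hρ.1
        rw [datumL_eq h𝔪 hray hsep hψ] at h0
        refine (mem_discZeros hdf hfc).2 ⟨?_, h0⟩
        rw [Metric.mem_closedBall, dist_eq_norm]
        have hγ : |ρ.im - j| ≤ 1 / 2 := by
          have hgj := hρ.2
          rw [hg] at hgj; dsimp only at hgj
          have h1 := Int.floor_le (ρ.im + 1 / 2)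
          have h2 := Int.lt_floor_add_one (ρ.im + 1 / 2)
          rw [hgj] at h1 h2
          rw [abs_le]; constructor <;> linarith
        have hre : (ρ - (2 + ((j : ℝ) : ℂ) * I)).re = ρ.re - 2 := by simp
        have him' : (ρ - (2 + ((j : ℝ) : ℂ) * I)).im = ρ.im - j := by simp
        have hsq : ‖ρ - (2 + ((j : ℝ) : ℂ) * I)‖ ^ 2 ≤ (31 / 16 : ℝ) ^ 2 := by
          rw [Complex.sq_norm, Complex.normSq_apply, hre, him']
          have h1 : (ρ.re - 2) * (ρ.re - 2) ≤ (7 / 4) ^ 2 := by nlinarith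
          have h2 : (ρ.im - j) * (ρ.im - j) ≤ (1 / 2) ^ 2 := by
            have := abs_le.1 hγ; nlinarith
          nlinarith
        nlinarith [norm_nonneg (ρ - (2 + ((j : ℝ) : ℂ) * I))]
      calc ∑ ρ ∈ (Z ψ).filter (fun ρ => g ρ = j), (zeroOrder g₀ ρ : ℝ)
          = ∑ ρ ∈ (Z ψ).filter (fun ρ => g ρ = j), (discDivisor g₀ (j : ℝ) ρ : ℝ) := by
            refine sum_congr rfl fun ρ hρ => ?_
            rw [discDivisor_eq_zeroOrder hdf hfc ((mem_discZeros hdf hfc).1 (hsub hρ)).1]; norm_cast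
        _ ≤ ∑ ρ ∈ discZeros g₀ (j : ℝ), (discDivisor g₀ (j : ℝ) ρ : ℝ) :=
            sum_le_sum_of_subset_of_nonneg hsub fun ρ _ _ => by exact_mod_cast discDivisor_nonneg hdf _ ρ
        _ ≤ 32 * rayDiscBound K 𝔪 (j : ℝ) := D.sum_discDivisor_le hnt _
        _ ≤ 32 * (10 * ((n : ℝ) + 1) * Lp) := mul_le_mul_of_nonneg_left (hdiscj j hj) (by norm_num)
    rw [← Finset.sum_fiberwise_of_maps_to hmaps]
    calc ∑ j ∈ J, ∑ ρ ∈ (Z ψ).filter (fun ρ => g ρ = j), (zeroOrder g₀ ρ : ℝ)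
        ≤ ∑ _j ∈ J, 32 * (10 * ((n : ℝ) + 1) * Lp) := sum_le_sum hfib
      _ = J.card * (32 * (10 * ((n : ℝ) + 1) * Lp)) := by rw [sum_const, nsmul_eq_mul]
      _ ≤ (5 * P) * (32 * (10 * ((n : ℝ) + 1) * Lp)) := mul_le_mul_of_nonneg_right hcardJ (by positivity)
  have hcardψ := card_filter_ne_zero_le (G := G) hh
  calc ∑ ψ ∈ (univ : Finset (AddChar (Additive G) ℂ)).filter (fun ψ => ψ ≠ 0),
        ∑ ρ ∈ Z ψ, (zeroOrder (datumL h𝔪 hray hsep ψ) ρ : ℝ)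
      ≤ ∑ ψ ∈ (univ : Finset (AddChar (Additive G) ℂ)).filter (fun ψ => ψ ≠ 0),
          (5 * P) * (32 * (10 * ((n : ℝ) + 1) * Lp)) := sum_le_sum fun ψ hψ => hper ψ (mem_filter.1 hψ).2
    _ = (((univ : Finset (AddChar (Additive G) ℂ)).filter (fun ψ => ψ ≠ 0)).card : ℝ) *
          ((5 * P) * (32 * (10 * ((n : ℝ) + 1) * Lp))) := by rw [sum_const, nsmul_eq_mul]
    _ ≤ P * ((5 * P) * (32 * (10 * ((n : ℝ) + 1) * Lp))) := mul_le_mul_of_nonneg_right hcardψ (by positivity)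
    _ ≤ P * ((5 * P) * (32 * (10 * ((n : ℝ) + 1) * P))) := by gcongr
    _ = 32 * (10 * ((n : ℝ) + 1)) * 5 * P ^ (3 : ℕ) := by ring

/-! ### The assembly -/

open scoped Classical in
/-- **The log-free zero-density estimate for the Hecke `L`-functions of a congruence class group, every degree**
(Bombieri's Théorème 14 for the family `{L_ψ}_{ψ ∈ Ĝ, ψ ≠ 0}`; Weiss 1983 Thm. 4.3, Thorner–Zaman 2017 Thm. 3.2 —
without the Deuring–Heilbronn factor): for every degree bound `n` there are `c_D, C_D > 0` such that for every
number field `K` with `n_K ≤ n`, every abelian Frobenius datum `f` killing the narrow ray `mod 𝔪 ≠ 0` whose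
non-trivial characters are non-principal on the primes `∤ 𝔪` (e.g. `G = Cl_K^𝔪`, all ray class characters
`mod 𝔪`), every `P ≥ 2` with `|d_K| ≤ P`, `N𝔪 ≤ P`, `|G| ≤ P`, `κ_K ≥ 1/P`, all finite sets `Z(ψ)` of zeros of
`L_ψ` with `1/4 ≤ β < 1`, `|γ| ≤ P`, and every `0 ≤ α ≤ 1`,
`Σ_{ψ ≠ 0} Σ_{ρ ∈ Z(ψ), β ≥ α} m(ρ) ≤ C_D P^{c_D(1−α)}`. [cite: Weiss1983, Theorem 4.3] -/
theorem logFreeDensity_congruence_all (n : ℕ) :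
    ∃ c_D C_D : ℝ, 0 < c_D ∧ 0 < C_D ∧
      ∀ (K : Type*) [Field K] [NumberField K], Module.finrank ℚ K ≤ n →
      ∀ (G : Type*) [CommGroup G] [Finite G] (𝔪 : Ideal (𝓞 K)) (f : HeightOneSpectrum (𝓞 K) → G)
        (h𝔪 : 𝔪 ≠ ⊥) (hray : ArtinKillsRay 𝔪 f)
        (hsep : ∀ χ : AddChar (Additive G) ℂ, χ ≠ 0 →
          ∃ v : HeightOneSpectrum (𝓞 K), ¬ 𝔪 ≤ v.asIdeal ∧ χ (Additive.ofMul (f v)) ≠ 1),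
        ∀ P : ℝ, 2 ≤ P → ((NumberField.discr K).natAbs : ℝ) ≤ P → ((Ideal.absNorm 𝔪 : ℕ) : ℝ) ≤ P →
          (Nat.card G : ℝ) ≤ P → P⁻¹ ≤ dedekindZeta_residue K →
        ∀ Z : AddChar (Additive G) ℂ → Finset ℂ,
          (∀ ψ : AddChar (Additive G) ℂ, ψ ≠ 0 → ∀ ρ ∈ Z ψ,
              datumL h𝔪 hray hsep ψ ρ = 0 ∧ 1 / 4 ≤ ρ.re ∧ ρ.re < 1 ∧ |ρ.im| ≤ P) →
          ∀ α : ℝ, 0 ≤ α → α ≤ 1 →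
            ∑ ψ : AddChar (Additive G) ℂ with ψ ≠ 0,
              ∑ ρ ∈ Z ψ with α ≤ ρ.re, (zeroOrder (datumL h𝔪 hray hsep ψ) ρ : ℝ) ≤ C_D * P ^ (c_D * (1 - α)) := by
  obtain ⟨δ₀, A, C, hδ₀, hA, hC, hmid⟩ := middleRange_congruence_of_le n one_pos
  obtain ⟨C₃, hC₃, hlarge⟩ := largeRange_congruence_of_le n
  set c_D : ℝ := max A (3 / δ₀) with hc_D
  set C_D : ℝ := max (max C (C * Real.exp A)) (max C₃ (C₃ * Real.exp (3 / δ₀))) with hC_D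
  refine ⟨c_D, C_D, lt_of_lt_of_le hA (le_max_left _ _), lt_of_lt_of_le hC ((le_max_left _ _).trans (le_max_left _ _)),
    fun K _ _ hnK G _ _ 𝔪 f h𝔪 hray hsep P hP hd hN𝔪 hh hκ Z hZ α hα0 hα1 => ?_⟩
  have hPpos : 0 < P := by linarith
  have hP1 : 1 ≤ P := by linarith
  set Lp := Real.log P with hLp
  have hLp2 : Real.log 2 ≤ Lp := Real.log_le_log (by norm_num) hP
  have hlog2 : (0.69 : ℝ) ≤ Real.log 2 := by have := Real.log_two_gt_d9; linarith
  have hLppos : 0 < Lp := by linarith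
  -- notation for the counts
  set N : ℝ → ℝ := fun β ↦ ∑ ψ : AddChar (Additive G) ℂ with ψ ≠ 0,
    ∑ ρ ∈ Z ψ with β ≤ ρ.re, (zeroOrder (datumL h𝔪 hray hsep ψ) ρ : ℝ) with hN
  have hNmono : ∀ β β' : ℝ, β' ≤ β → N β ≤ N β' := by
    intro β β' hββ'
    refine sum_le_sum fun ψ _ ↦ sum_le_sum_of_subset_of_nonneg ?_ fun ρ _ _ ↦ Nat.cast_nonneg _
    intro ρ hρ
    rw [mem_filter] at hρ ⊢
    exact ⟨hρ.1, hββ'.trans hρ.2⟩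
  have hNtot : ∀ β : ℝ, N β ≤ C₃ * P ^ (3 : ℕ) := by
    intro β
    have h := hlarge K hnK G 𝔪 f h𝔪 hray hsep P hP hd hN𝔪 hh Z
      (fun ψ hψ ρ hρ ↦ ⟨(hZ ψ hψ ρ hρ).1, (hZ ψ hψ ρ hρ).2.1, (hZ ψ hψ ρ hρ).2.2.1.le, (hZ ψ hψ ρ hρ).2.2.2⟩)
    refine le_trans ?_ h
    refine sum_le_sum fun ψ _ ↦ sum_le_sum_of_subset_of_nonneg (filter_subset _ _) fun ρ _ _ ↦ Nat.cast_nonneg _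
  have hZ' : ∀ ψ : AddChar (Additive G) ℂ, ψ ≠ 0 → ∀ ρ ∈ Z ψ,
      datumL h𝔪 hray hsep ψ ρ = 0 ∧ 0 < ρ.re ∧ ρ.re < 1 ∧ |ρ.im| ≤ P :=
    fun ψ hψ ρ hρ ↦ ⟨(hZ ψ hψ ρ hρ).1, by linarith [(hZ ψ hψ ρ hρ).2.1], (hZ ψ hψ ρ hρ).2.2.1, (hZ ψ hψ ρ hρ).2.2.2⟩
  have hexp0 : 0 ≤ c_D * (1 - α) := mul_nonneg (by positivity) (by linarith)
  have hPpow1 : 1 ≤ P ^ (c_D * (1 - α)) := Real.one_le_rpow hP1 hexp0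
  have hCD_C : C ≤ C_D := (le_max_left _ _).trans (le_max_left _ _)
  have hCD_CA : C * Real.exp A ≤ C_D := (le_max_right _ _).trans (le_max_left _ _)
  have hCD_C₃ : C₃ ≤ C_D := (le_max_left _ _).trans (le_max_right _ _)
  have hCD_C₃e : C₃ * Real.exp (3 / δ₀) ≤ C_D := (le_max_right _ _).trans (le_max_right _ _)
  have hCD0 : 0 ≤ C_D := hC.le.trans hCD_C
  show N α ≤ C_D * P ^ (c_D * (1 - α))
  rcases lt_or_ge δ₀ (1 - α) with hbig | hsmall
  · -- `1 - α > δ₀`: the trivial bound, `P³ ≤ P^{(3/δ₀)(1-α)}`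
    have h3 : (3 : ℝ) ≤ c_D * (1 - α) := by
      have h1 : 3 / δ₀ * (1 - α) ≤ c_D * (1 - α) := mul_le_mul_of_nonneg_right (le_max_right _ _) (by linarith)
      have h2 : (3 : ℝ) ≤ 3 / δ₀ * (1 - α) := by
        rw [div_mul_eq_mul_div, le_div_iff₀ hδ₀]; nlinarith
      linarith
    calc N α ≤ C₃ * P ^ (3 : ℕ) := hNtot α
      _ ≤ C_D * P ^ (c_D * (1 - α)) := by
          refine mul_le_mul hCD_C₃ ?_ (by positivity) hCD0
          rw [← Real.rpow_natCast]
          exact Real.rpow_le_rpow_of_exponent_le hP1 (by exact_mod_cast h3)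
  · rcases le_or_gt (1 / Lp) (1 - α) with hmidr | htiny
    · -- the middle range
      have h := hmid K hnK G 𝔪 f h𝔪 hray hsep P hP hd hN𝔪 hh hκ Z hZ' α hmidr hsmall
      calc N α ≤ C * P ^ (A * (1 - α)) := h
        _ ≤ C_D * P ^ (c_D * (1 - α)) := by
            refine mul_le_mul hCD_C ?_ (by positivity) hCD0
            exact Real.rpow_le_rpow_of_exponent_le hP1 (mul_le_mul_of_nonneg_right (le_max_left _ _) (by linarith))
    · -- `1 - α < 1/log P`: compare with `α' = 1 - 1/log P` (or use the trivial bound if `P` is small)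
      rcases le_or_gt (1 / Lp) δ₀ with hPlarge | hPsmall
      · set α' : ℝ := 1 - 1 / Lp with hα'
        have hle : N α ≤ N α' := hNmono α α' (by rw [hα']; linarith)
        have h := hmid K hnK G 𝔪 f h𝔪 hray hsep P hP hd hN𝔪 hh hκ Z hZ' α' (by rw [hα', hLp]; simp)
          (by rw [hα']; simpa using hPlarge)
        have hpow : P ^ (A * (1 - α')) = Real.exp A := by
          rw [hα', sub_sub_cancel, Real.rpow_def_of_pos hPpos, ← hLp]
          congr 1; field_simp
        calc N α ≤ N α' := hle
          _ ≤ C * P ^ (A * (1 - α')) := h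
          _ = C * Real.exp A := by rw [hpow]
          _ ≤ C_D * P ^ (c_D * (1 - α)) := by
              calc C * Real.exp A = C * Real.exp A * 1 := (mul_one _).symm
                _ ≤ C_D * P ^ (c_D * (1 - α)) := mul_le_mul hCD_CA hPpow1 zero_le_one hCD0
      · -- `P < e^{1/δ₀}`: `P³ ≤ e^{3/δ₀}`
        have hLpδ : Lp ≤ 1 / δ₀ := by
          have h1 : 1 / Lp > δ₀ := hPsmall
          rw [gt_iff_lt, lt_div_iff₀ hLppos] at h1
          rw [le_div_iff₀ hδ₀]; linarith
        have hP3 : P ^ (3 : ℕ) ≤ Real.exp (3 / δ₀) := by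
          have hPexp : P = Real.exp Lp := (Real.exp_log hPpos).symm
          have h3 : Real.exp Lp ^ (3 : ℕ) = Real.exp ((3 : ℕ) * Lp) := (Real.exp_nat_mul Lp 3).symm
          rw [hPexp, h3]
          refine Real.exp_le_exp.mpr ?_
          push_cast
          have := mul_le_mul_of_nonneg_left hLpδ (show (0:ℝ) ≤ 3 by norm_num)
          have e : 3 * (1 / δ₀) = 3 / δ₀ := by ring
          linarith
        calc N α ≤ C₃ * P ^ (3 : ℕ) := hNtot α
          _ ≤ C₃ * Real.exp (3 / δ₀) := mul_le_mul_of_nonneg_left hP3 hC₃.le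
          _ = C₃ * Real.exp (3 / δ₀) * 1 := (mul_one _).symm
          _ ≤ C_D * P ^ (c_D * (1 - α)) := mul_le_mul hCD_C₃e hPpow1 zero_le_one hCD0

end Literature.NumberTheory.LFunctions.AbelianDensity

end
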